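import Mathlib
import Literature.ModelTheory.ExponentialFields.CylindricalDecompositionProofs
import Literature.NumberTheory.Transcendental.SemialgebraicMapsProofs
import Summits.KontsevichZagierPeriods.KontsevichZagierPeriods.Theorems.SoloInformedNashCubulation
import HarnessLib

/-!
# SoloInformed — toolkit for Nash cubulation in dimension one

`SoloInformedNashCubulation` restricted to `m = 1` is a THEOREM: every `ℚ`-semialgebraic
`K ⊆ [0,1]` is, up to finitely many points, a disjoint union of open intervals with real-algebraic
end points, each the image of `(0,1)` under an affine map `s ↦ a + (b - a) s` with
`ℚ`-semialgebraic graph and constant Jacobian `b - a`, an algebraic number, i.e. the real part of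
a constant cube germ.
The proof runs the tree's adapted cylindrical decomposition
(`IsSemialgebraic.exists_cylindricalDecomposition_holds`, [Basu–Pollack–Roy 2006, Cor. 5.7]) at
level `1`: cells of `ℝ¹` are graphs (points) and bands (open intervals) of `ℚ`-semialgebraic
sections over the point `ℝ⁰`.

This file (the toolkit; the theorem is in `SoloInformedCubulationOne`):
* `soloInformed_locallyConst_of_isSemialgebraic` — membership in a `ℚ`-semialgebraic subset of
  `ℝ¹` is locally constant off a finite set of algebraic numbers (hence a `ℚ`-semialgebraic
  point of `ℝ¹` is algebraic, used in `SoloInformedCubulationOne`);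
* `soloInformedConstGerm` — constant cube germs with algebraic value;
* `SoloInformedCubulation.ofFintype` — reindexing a cubulation datum by a finite type;
* `soloInformedAffine` — affine charts of bounded intervals: derivative, injectivity, image,
  `ℚ`-semialgebraicity; boundaries of bands over the point `ℝ⁰`.

References: Basu–Pollack–Roy 2006, Def. 5.1, Cor. 5.7; BCR 1998, Prop. 2.2.6; KZ 2001 §1.2.
-/

noncomputable section

open scoped BigOperators Topology
open MeasureTheory Set Filter Polynomial
open Literature.ModelTheory.ExponentialFields
open Literature.NumberTheory.Transcendental Literature.NumberTheory.Transcendental.KZ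

namespace Summit.KontsevichZagierPeriods.KontsevichZagierPeriods.Theorems

/-! ### `ℚ`-semialgebraic points of the line are algebraic -/

/-- The univariate polynomial underlying `p ∈ ℚ[X₀]`. -/
def soloInformedUnivariate (p : MvPolynomial (Fin 1) ℚ) : ℚ[X] :=
  MvPolynomial.aeval (fun _ : Fin 1 => (Polynomial.X : ℚ[X])) p

/-- Evaluation of `p ∈ ℚ[X₀]` at a point of `ℝ¹` is evaluation of its univariate form. [folklore] -/
theorem soloInformed_aeval_fin_one (p : MvPolynomial (Fin 1) ℚ) (x : Fin 1 → ℝ) :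
    MvPolynomial.aeval x p = Polynomial.aeval (x 0) (soloInformedUnivariate p) := by
  have hx : x = fun _ => x 0 := KZ.eq_const_apply_zero x
  conv_lhs => rw [hx]
  rw [soloInformedUnivariate, ← AlgHom.comp_apply, MvPolynomial.comp_aeval]
  simp

/-- **Local constancy off the critical values.** Membership in a `ℚ`-semialgebraic subset of `ℝ¹`
is locally constant near every point whose coordinate avoids a finite set of algebraic
numbers (the real roots of the nonzero polynomials in a description of the set). [BCR 1998, §2.1] -/
theorem soloInformed_locallyConst_of_isSemialgebraic {s : Set (Fin 1 → ℝ)}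
    (hs : IsSemialgebraic ℚ s) :
    ∃ F : Finset ℝ, (∀ a ∈ F, IsAlgebraic ℚ a) ∧
      ∀ x : Fin 1 → ℝ, x 0 ∉ F → ∀ᶠ y in 𝓝 x, (y ∈ s ↔ x ∈ s) := by
  classical
  induction hs using BooleanSubalgebra.closure_bot_sup_induction with
  | mem s hs =>
    -- a generator: zero set or positivity set of `p`
    have key : ∀ p : MvPolynomial (Fin 1) ℚ, ∃ F : Finset ℝ, (∀ a ∈ F, IsAlgebraic ℚ a) ∧
        ∀ x : Fin 1 → ℝ, x 0 ∉ F → ∀ᶠ y in 𝓝 x,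
          ((MvPolynomial.aeval y p = 0 ↔ MvPolynomial.aeval x p = 0) ∧
            (0 < MvPolynomial.aeval y p ↔ 0 < MvPolynomial.aeval x p)) := by
      intro p
      set q := soloInformedUnivariate p with hq
      by_cases hq0 : q = 0
      · refine ⟨∅, by simp, fun x _ => Eventually.of_forall fun y => ?_⟩
        simp [soloInformed_aeval_fin_one, ← hq, hq0]
      refine ⟨(q.aroots ℝ).toFinset, fun a ha => ?_, fun x hx => ?_⟩
      · rw [Multiset.mem_toFinset, Polynomial.mem_aroots] at ha
        exact ⟨q, hq0, ha.2⟩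
      have hx' : Polynomial.aeval (x 0) q ≠ 0 := by
        intro h0
        apply hx
        rw [Multiset.mem_toFinset, Polynomial.mem_aroots]
        exact ⟨hq0, h0⟩
      have hcont : Continuous fun y : Fin 1 → ℝ => Polynomial.aeval (y 0) q := by
        simp only [Polynomial.aeval_def, Polynomial.eval₂_eq_eval_map]
        exact (Polynomial.continuous _).comp (continuous_apply 0)
      have hne : ∀ᶠ y in 𝓝 x, Polynomial.aeval (y 0) q ≠ 0 :=
        hcont.continuousAt.eventually_ne hx'
      rcases lt_or_gt_of_ne hx' with hlt | hgt
      · have hev : ∀ᶠ y in 𝓝 x, Polynomial.aeval (y 0) q < 0 := hcont.continuousAt.eventually_lt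
          continuousAt_const hlt
        filter_upwards [hev] with y hy
        simp only [soloInformed_aeval_fin_one, ← hq]
        exact ⟨by simp [hy.ne, hlt.ne], by simp [not_lt.2 hy.le, not_lt.2 hlt.le]⟩
      · have hev : ∀ᶠ y in 𝓝 x, 0 < Polynomial.aeval (y 0) q :=
          continuousAt_const.eventually_lt hcont.continuousAt hgt
        filter_upwards [hev] with y hy
        simp only [soloInformed_aeval_fin_one, ← hq]
        exact ⟨by simp [hy.ne', hgt.ne'], by simp [hy, hgt]⟩
    rcases hs with ⟨p, rfl⟩ | ⟨p, rfl⟩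
    · obtain ⟨F, hF, h⟩ := key p
      exact ⟨F, hF, fun x hx => (h x hx).mono fun y hy => hy.1⟩
    · obtain ⟨F, hF, h⟩ := key p
      exact ⟨F, hF, fun x hx => (h x hx).mono fun y hy => hy.2⟩
  | bot => exact ⟨∅, by simp, fun x _ => Eventually.of_forall fun y => by simp⟩
  | sup s _ t _ hs ht =>
    obtain ⟨F, hF, h⟩ := hs
    obtain ⟨F', hF', h'⟩ := ht
    refine ⟨F ∪ F', fun a ha => ?_, fun x hx => ?_⟩
    · rcases Finset.mem_union.1 ha with ha | ha
      exacts [hF a ha, hF' a ha]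
    · rw [Finset.mem_union, not_or] at hx
      filter_upwards [h x hx.1, h' x hx.2] with y hy hy'
      change y ∈ s ∪ t ↔ x ∈ s ∪ t
      rw [mem_union, mem_union, hy, hy']
  | compl s _ hs =>
    obtain ⟨F, hF, h⟩ := hs
    refine ⟨F, hF, fun x hx => ?_⟩
    filter_upwards [h x hx] with y hy
    change y ∉ s ↔ x ∉ s
    rw [hy]

/-! ### Constant cube germs -/

/-- The polynomial `q(T) ∈ ℚ[z₁, …, zₙ, T]` attached to `q ∈ ℚ[T]` (last variable). -/
def soloInformedLastVar (n : ℕ) (q : ℚ[X]) : MvPolynomial (Fin (n + 1)) ℚ :=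
  Polynomial.aeval (MvPolynomial.X (Fin.last n) : MvPolynomial (Fin (n + 1)) ℚ) q

/-- Evaluating `q(T)` at `w` evaluates `q` at the last coordinate. [folklore] -/
theorem soloInformed_aeval_lastVar {A : Type*} [CommRing A] [Algebra ℚ A] (n : ℕ) (q : ℚ[X])
    (w : Fin (n + 1) → A) :
    MvPolynomial.aeval w (soloInformedLastVar n q) = Polynomial.aeval (w (Fin.last n)) q := by
  rw [soloInformedLastVar, ← Polynomial.aeval_algHom_apply, MvPolynomial.aeval_X]

/-- `q(T) ≠ 0` for `q ≠ 0`. [folklore] -/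
theorem soloInformed_lastVar_ne_zero (n : ℕ) {q : ℚ[X]} (hq : q ≠ 0) :
    soloInformedLastVar n q ≠ 0 := by
  intro h
  apply hq
  refine Polynomial.eq_zero_of_infinite_isRoot q ?_
  have : ∀ t : ℚ, q.IsRoot t := fun t => by
    have h1 := soloInformed_aeval_lastVar (A := ℚ) n q (Fin.snoc 0 t)
    rw [h, map_zero, Fin.snoc_last, Polynomial.coe_aeval_eq_eval] at h1
    exact h1.symm
  exact Set.infinite_univ.mono fun t _ => this t

/-- **Constant cube germ** with an algebraic value `d`: `g ≡ d` on `ℂⁿ`, algebraic through the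
minimal polynomial of `d`. -/
def soloInformedConstGerm (n : ℕ) (d : ℝ) (hd : IsAlgebraic ℚ d) : SoloInformedCubeGerm n where
  U := univ
  g := fun _ => (d : ℂ)
  isOpen := isOpen_univ
  mapsTo := mapsTo_univ _ _
  analytic := fun _ _ => analyticAt_const
  real := fun _ _ => by simp
  algebraic := by
    refine ⟨soloInformedLastVar n (minpoly ℚ d),
      soloInformed_lastVar_ne_zero n (minpoly.ne_zero hd.isIntegral), fun z _ => ?_⟩
    rw [soloInformed_aeval_lastVar, Fin.snoc_last, ← Complex.coe_algebraMap,
      Polynomial.aeval_algebraMap_apply, minpoly.aeval, map_zero]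

/-- The function of a constant germ is the constant. -/
@[simp] theorem soloInformedConstGerm_g (n : ℕ) (d : ℝ) (hd : IsAlgebraic ℚ d) (w : Fin n → ℂ) :
    (soloInformedConstGerm n d hd).g w = d := rfl

/-! ### Reindexing cubulation data -/

/-- A cubulation datum indexed by a finite type. -/
def SoloInformedCubulation.ofFintype {m : ℕ} {K : Set (Fin m → ℝ)} {ι : Type*} [Fintype ι]
    (Φ : ι → (Fin m → ℝ) → (Fin m → ℝ)) (Φ' : ι → (Fin m → ℝ) → ((Fin m → ℝ) →L[ℝ] (Fin m → ℝ)))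
    (G : ι → SoloInformedCubeGerm m)
    (h₁ : ∀ i, IsSemialgebraicMapOn ℚ (soloInformedOpenCube m) (Φ i))
    (h₂ : ∀ i, ∀ x ∈ soloInformedOpenCube m,
      HasFDerivWithinAt (Φ i) (Φ' i x) (soloInformedOpenCube m) x)
    (h₃ : ∀ i, InjOn (Φ i) (soloInformedOpenCube m))
    (h₄ : ∀ i, Φ i '' soloInformedOpenCube m ⊆ K)
    (h₅ : ∀ i j, i ≠ j → volume (Φ i '' soloInformedOpenCube m ∩ Φ j '' soloInformedOpenCube m) = 0)
    (h₆ : volume (K \ ⋃ i, Φ i '' soloInformedOpenCube m) = 0)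
    (h₇ : ∀ i, ∀ x ∈ soloInformedOpenCube m, ((G i).g (soloInformedToC m x)).re = |(Φ' i x).det|) :
    SoloInformedCubulation K where
  k := Fintype.card ι
  Φ i := Φ ((Fintype.equivFin ι).symm i)
  Φ' i := Φ' ((Fintype.equivFin ι).symm i)
  G i := G ((Fintype.equivFin ι).symm i)
  semialgebraic i := h₁ _
  hasFDerivWithinAt i := h₂ _
  injOn i := h₃ _
  subset i := h₄ _
  almostDisjoint i j hij := h₅ _ _ fun h => hij ((Fintype.equivFin ι).symm.injective h)
  cover := by
    rwa [(Fintype.equivFin ι).symm.surjective.iUnion_comp fun i => Φ i '' soloInformedOpenCube m]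
  jacobian i := h₇ _

/-! ### Affine charts of bounded intervals -/

/-- The affine chart `s ↦ a + (b - a) s` (coordinatewise) of the interval `(a, b)`. -/
def soloInformedAffine (a b : ℝ) (v : Fin 1 → ℝ) : Fin 1 → ℝ := fun i => a + (b - a) * v i

/-- Evaluation formula for the affine map of an interval onto `[0,1]`-coordinates. -/
@[simp] theorem soloInformedAffine_apply (a b : ℝ) (v : Fin 1 → ℝ) (i : Fin 1) :
    soloInformedAffine a b v i = a + (b - a) * v i := rfl

/-- The affine chart is differentiable with derivative `(b - a) • id`. [folklore] -/
theorem soloInformed_hasFDerivAt_affine (a b : ℝ) (v : Fin 1 → ℝ) :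
    HasFDerivAt (soloInformedAffine a b) ((b - a) • ContinuousLinearMap.id ℝ (Fin 1 → ℝ)) v := by
  have h : soloInformedAffine a b = fun v => (fun _ => a) + (b - a) • v := by
    funext v i; simp [smul_eq_mul]
  rw [h]
  exact ((hasFDerivAt_id v).const_smul (b - a)).const_add _

/-- The affine chart of a nondegenerate interval is injective. [folklore] -/
theorem soloInformed_injective_affine {a b : ℝ} (hab : a < b) :
    Function.Injective (soloInformedAffine a b) := fun v w h => funext fun i => by
  have hi := congr_fun h i
  simp only [soloInformedAffine_apply, add_right_inj] at hi
  exact mul_left_cancel₀ (sub_pos.2 hab).ne' hi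

/-- The affine chart maps the open cube `(0,1)¹` onto the interval `(a, b)`. [folklore] -/
theorem soloInformed_image_affine {a b : ℝ} (hab : a < b) :
    soloInformedAffine a b '' soloInformedOpenCube 1 = {w | ∀ i, a < w i ∧ w i < b} := by
  have hd : 0 < b - a := sub_pos.2 hab
  ext w
  simp only [mem_image, soloInformed_mem_openCube_iff, mem_setOf_eq]
  constructor
  · rintro ⟨v, hv, rfl⟩ i
    obtain ⟨h0, h1⟩ := hv i
    refine ⟨by simp only [soloInformedAffine_apply]; nlinarith, ?_⟩
    simp only [soloInformedAffine_apply]; nlinarith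
  · intro hw
    refine ⟨fun i => (w i - a) / (b - a), fun i => ⟨div_pos (sub_pos.2 (hw i).1) hd, ?_⟩, ?_⟩
    · rw [div_lt_one hd]; linarith [(hw i).2]
    · funext i
      simp only [soloInformedAffine_apply]
      field_simp
      ring

/-- The affine chart with `ℚ`-semialgebraic constants `a`, `b` is a `ℚ`-semialgebraic map on the
open cube (sums and products of semialgebraic functions, [BCR 1998, Prop. 2.2.6]). -/
theorem soloInformed_isSemialgebraicMapOn_affine {a b : ℝ}
    (ha : IsSemialgebraicFunOn ℚ (univ : Set (Fin 1 → ℝ)) fun _ => a)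
    (hb : IsSemialgebraicFunOn ℚ (univ : Set (Fin 1 → ℝ)) fun _ => b) :
    IsSemialgebraicMapOn ℚ (soloInformedOpenCube 1) (soloInformedAffine a b) := by
  have hC := isSemialgebraic_soloInformedOpenCube 1
  refine IsSemialgebraicMapOn.of_forall hC fun i => ?_
  have ha' := ha.mono (subset_univ _) hC
  have hb' := hb.mono (subset_univ _) hC
  have hx : IsSemialgebraicFunOn ℚ (soloInformedOpenCube 1) fun v : Fin 1 → ℝ => v i :=
    (isSemialgebraicFunOn_aeval hC (MvPolynomial.X i)).congr fun v _ => by simp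
  exact (IsSemialgebraicFunOn.add_holds ha'
    (IsSemialgebraicFunOn.mul_holds (IsSemialgebraicFunOn.sub_holds hb' ha') hx)).congr
    fun v _ => by simp

/-! ### Boundaries of bands over the point -/

/-- An upper band boundary is `+∞` or real. [Basu–Pollack–Roy 2006, Def. 5.1] -/
theorem soloInformed_bandUpper_cases {L n : ℕ} (ξ : Fin L → (Fin n → ℝ) → ℝ) (j : Fin (L + 1))
    (x : Fin n → ℝ) : bandUpper ξ j x = ⊤ ∨ ∃ r : ℝ, bandUpper ξ j x = r := by
  induction j using Fin.lastCases with
  | last => simp [bandUpper]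
  | cast i => simp [bandUpper]

/-- A lower band boundary is `-∞` or real. [Basu–Pollack–Roy 2006, Def. 5.1] -/
theorem soloInformed_bandLower_cases {L n : ℕ} (ξ : Fin L → (Fin n → ℝ) → ℝ) (j : Fin (L + 1))
    (x : Fin n → ℝ) : bandLower ξ j x = ⊥ ∨ ∃ r : ℝ, bandLower ξ j x = r := by
  induction j using Fin.cases with
  | zero => simp
  | succ i => simp

/-- The lowest band over the point is not contained in the unit interval. -/
theorem soloInformed_band_zero_not_subset {L : ℕ} (ξ : Fin L → (Fin 0 → ℝ) → ℝ) :
    ¬ bandOver univ ξ 0 ⊆ soloInformedCube 1 := by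
  intro h
  obtain ⟨t, ht0, ht⟩ : ∃ t : ℝ, t < 0 ∧ (t : EReal) < bandUpper ξ 0 (Fin.elim0 : Fin 0 → ℝ) := by
    rcases soloInformed_bandUpper_cases ξ 0 (Fin.elim0 : Fin 0 → ℝ) with htop | ⟨r, hr⟩
    · exact ⟨-1, by norm_num, by rw [htop]; exact EReal.coe_lt_top _⟩
    · refine ⟨min r 0 - 1, by linarith [min_le_right r 0], ?_⟩
      rw [hr, EReal.coe_lt_coe_iff]; linarith [min_le_left r 0]
  have hmem : (fun _ => t : Fin 1 → ℝ) ∈ bandOver univ ξ 0 := by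
    rw [mem_bandOver_iff]
    refine ⟨mem_univ _, by simp, ?_⟩
    rwa [Subsingleton.elim (Fin.init fun _ : Fin 1 => t) Fin.elim0]
  have := (soloInformed_mem_cube_iff.1 (h hmem)) 0
  linarith [this.1]

/-- The highest band over the point is not contained in the unit interval. -/
theorem soloInformed_band_last_not_subset {L : ℕ} (ξ : Fin L → (Fin 0 → ℝ) → ℝ) :
    ¬ bandOver univ ξ (Fin.last L) ⊆ soloInformedCube 1 := by
  intro h
  obtain ⟨t, ht1, ht⟩ : ∃ t : ℝ, 1 < t ∧
      bandLower ξ (Fin.last L) (Fin.elim0 : Fin 0 → ℝ) < (t : EReal) := by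
    rcases soloInformed_bandLower_cases ξ (Fin.last L) (Fin.elim0 : Fin 0 → ℝ) with hbot | ⟨r, hr⟩
    · exact ⟨2, by norm_num, by rw [hbot]; exact EReal.bot_lt_coe _⟩
    · refine ⟨max r 1 + 1, by linarith [le_max_right r 1], ?_⟩
      rw [hr, EReal.coe_lt_coe_iff]; linarith [le_max_left r 1]
  have hmem : (fun _ => t : Fin 1 → ℝ) ∈ bandOver univ ξ (Fin.last L) := by
    rw [mem_bandOver_iff]
    refine ⟨mem_univ _, ?_, by simp [bandUpper]⟩
    rwa [Subsingleton.elim (Fin.init fun _ : Fin 1 => t) Fin.elim0]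
  have := (soloInformed_mem_cube_iff.1 (h hmem)) 0
  linarith [this.2]

/-- An interior band over the point is a bounded open interval. [Basu–Pollack–Roy 2006, Def. 5.1] -/
theorem soloInformed_bandOver_eq {L : ℕ} (ξ : Fin L → (Fin 0 → ℝ) → ℝ) (j : Fin (L + 1))
    (h0 : j ≠ 0) (hl : j ≠ Fin.last L) :
    bandOver univ ξ j = {w : Fin 1 → ℝ | ∀ i, ξ (j.pred h0) Fin.elim0 < w i ∧
      w i < ξ (j.castPred hl) Fin.elim0} := by
  ext w
  rw [mem_bandOver_iff, bandLower_of_ne_zero ξ j h0, bandUpper_of_ne_last ξ j hl,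
    Subsingleton.elim (Fin.init w) Fin.elim0, EReal.coe_lt_coe_iff, EReal.coe_lt_coe_iff]
  simp only [mem_univ, true_and, mem_setOf_eq, Fin.forall_fin_one]
  rfl

end Summit.KontsevichZagierPeriods.KontsevichZagierPeriods.Theorems
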